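import Literature.MathematicalPhysics.QuantumFieldTheory.Balaban1983to89.B7ConclKExp
import Literature.MathematicalPhysics.QuantumFieldTheory.Balaban1983to89.B7ConclGauge

/-!
# `Balaban1983to89.B7ConclConcrete` — T. Bałaban, *Averaging operations for lattice gauge theories*, Commun. Math. Phys. **98** (1985) 17–51
[Balaban1985Averaging]: **the leaf `B7.Concl` of `B7.lean` — the conjunction of the ten typed printed statements `B7.Prop1Printed` …
`B7.Prop10Printed` (Props. 1–10, pp. 26–50) — INHABITED at the concrete `ℤᵈ` carriers of the lineage**, for every dimension `d`, every block size
`L ≥ 2`, every nontrivial C⋆-algebra `𝔸` (print: `M_N(ℂ)` with the operator norm (19)) and the gauge group `G = U(𝔸)` (print: `U(N)`).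

statement-level skeleton of published theorems with citation tags; proofs where landed; nothing here is a claim about the Yang–Mills mass gap

CITATION HEADER (lean-in-tree rule).  Cell `lit-balaban`, unit `lit-balaban-r04` (owner of block B7, gen 6).  ASSEMBLY of the model-instance files
`B7ConclOneStep` (`p1`, `p3`), `B7Prop2Explicit` (`p2`: `prop2Printed_concrete`, b07 lineage), `B7ConclKExp` (`p4`–`p7`), `B7ConclGauge` (`p8`–`p10`).
Every conjunct is the decl of record of its SKELETON row (`B7.Prop1` … `B7.Prop10`) AS TYPED in `B7.lean`, proved for a NAMED concrete family; the
constants of the leaf are `L`, Prop. 2's `c₂ = min{1/(3C₀), ½c₂′}` (`B7ConclGauge.cB`), `C₀ = B7Prop2Explicit.C0 d = 14464(d+1)²(d+4)²`,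
`c₂′ = B7Prop2Explicit.c2' d L = 1/(512(d+1)(d+4)L²)`.  CONSEQUENCE for the cell `pub-balaban`'s DAG ledger (not imported here — `DagDischargedII` is a
standalone leaf of the import graph): by `DagDischargedII.b7Concl_iff_p12_and_rest`, the «quoted rest» `B7LeafRest` of leaf `b7` holds for these
carriers, i.e. leaf `b7` needs no quotation at the concrete carriers (recording that is the CARVER seat's business).

PRINT: Propositions 1–10 of [Balaban1985Averaging], pp. 26, 26, 36, 38–39, 42, 43, 43, 45, 49, 50 (verbatim in the docstrings of `B7.lean`).

WHAT THIS FILE PROVES (kernel, no `sorry`, standard axioms): `concl_concrete d L (hL : 2 ≤ L) 𝔸 : B7.Concl L c₂ C₀ c₂′ one kst kexp gd gone` with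
`one = B7ConclOneStep.concreteOneStepBD 𝔸 L`, `kst = fun k => B7Prop2Explicit.concreteKStep d 𝔸 (unitaryUnits 𝔸) L k`,
`kexp = B7ConclKExp.concreteKExp 𝔸 (unitaryUnits 𝔸) L`, `gd = B7ConclGauge.concreteGaugeData 𝔸 L`, `gone = B7ConclGauge.concreteGaugeOneStep 𝔸 L`;
and `concl_concrete_fields` (`rfl` bookkeeping of the carriers' printed parameters `k`, `η = L^{−k}`, `L`).
READINGS: those of the three instance files (located there).  NOT CLAIMED: anything about other carriers; nothing of the series' end-statement.
DECLARATIONS: theorems only.  Unit `lit-balaban-r04` (gen 6), 2026-08-21.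

[cite: Balaban1985Averaging, Props. 1–2 p.26, Prop. 3 p.36, Prop. 4 pp.38–39, Prop. 5 p.42, Props. 6–7 p.43, Prop. 8 p.45, Prop. 9 p.49, Prop. 10 p.50]
-/

noncomputable section

namespace Literature.MathematicalPhysics.QuantumFieldTheory.Balaban1983to89.B7ConclConcrete

open B7Prop1Explicit B7Prop2Explicit B7ConclOneStep B7ConclKExp B7ConclGauge

-- `Site` alone would resolve to the torus sites of `Setup.lean`; re-export the `ℤ^d` sites of `B7Prop1Explicit`.
export B7Prop1Explicit (Site)

/-- **`B7.Concl` INHABITED at the concrete carriers** — Propositions 1–10 of [Balaban1985Averaging] AS TYPED, each for a named concrete family on `ℤᵈ`,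
with the leaf's constants `L`, `c₂ = min{1/(3C₀), ½c₂′}`, `C₀ = 14464(d+1)²(d+4)²`, `c₂′ = 1/(512(d+1)(d+4)L²)`; every `d`, every `L ≥ 2`, every
nontrivial C⋆-algebra `𝔸`, gauge group `U(𝔸)`. [cite: Balaban1985Averaging, Props. 1–2 p.26, Prop. 3 p.36, Prop. 4 pp.38–39, Prop. 5 p.42, Props. 6–7 p.43, Prop. 8 p.45, Prop. 9 p.49, Prop. 10 p.50] -/
theorem concl_concrete (d L : ℕ) (hL : 2 ≤ L) (𝔸 : Type) [CStarAlgebra 𝔸] [Nontrivial 𝔸] :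
    B7.Concl (L : ℝ) (cB d L) (C0 d) (c2' d L)
      (concreteOneStepBD 𝔸 (d := d) L)
      (fun k : ℕ => concreteKStep d 𝔸 (unitaryUnits 𝔸) L k)
      (concreteKExp 𝔸 (unitaryUnits 𝔸) (d := d) L)
      (concreteGaugeData 𝔸 (d := d) L)
      (concreteGaugeOneStep 𝔸 (d := d) L) :=
  have hL1 : 1 ≤ L := le_trans (by norm_num) hL
  { p1 := prop1Printed_BD L hL1
    p2 := prop2Printed_concrete L hL (avgClosed_unitaryUnits d L)
    p3 := prop3Printed_BD L hL1 (cB_pos d hL1)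
    p4 := prop4Printed_K L hL (avgClosed_unitaryUnits d L)
    p5 := prop5Printed_K L hL (avgClosed_unitaryUnits d L)
    p6 := prop6Printed_K L hL (avgClosed_unitaryUnits d L)
    p7 := prop7Printed_K L hL (avgClosed_unitaryUnits d L)
    p8 := prop8Printed_G L hL
    p9 := prop9Printed_G L hL1
    p10 := prop10Printed_G L hL }

/-- Bookkeeping (`rfl`): the carriers carry the printed parameters — the `k`-step and `k`-fold families are indexed by the order `k` with
`η = L^{−k}`, the gauge family carries `L` and `η = L^{−k}`. [cite: Balaban1985Averaging, (1) p.17, p.19] -/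
theorem concl_concrete_fields (d L : ℕ) (𝔸 : Type) [CStarAlgebra 𝔸] [Nontrivial 𝔸] (i : KIdx d) (g : GIdx 𝔸 d L) :
    (concreteKExp 𝔸 (unitaryUnits 𝔸) (d := d) L i).k = i.k ∧ (concreteGaugeData 𝔸 (d := d) L g).k = g.k ∧
      (concreteGaugeData 𝔸 (d := d) L g).eta = ((L : ℝ) ^ g.k)⁻¹ ∧ (concreteGaugeData 𝔸 (d := d) L g).L = (L : ℝ) ∧
      (concreteKStep d 𝔸 (unitaryUnits 𝔸) L i.k).k = i.k :=
  ⟨rfl, rfl, rfl, rfl, rfl⟩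

end Literature.MathematicalPhysics.QuantumFieldTheory.Balaban1983to89.B7ConclConcrete

end
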